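import Mathlib
import Literature.Combinatorics.Additive.TripleProductProperty
import Literature.Computability.AlgebraicComplexity.CohnUmansTPP
import Summits.MatrixMultiplication.MatrixMultiplication.Theorems.SnSubsetDichotomyPolynomialSlackStubSplit

/-!
# `SnSubsetDichotomy.PolynomialSlack` — the SHADOW INEQUALITY for triple-product-property triples
(helper lemmas `--supports stmt-MatrixMultiplication-8306`; valid in every group)

For a triple `(S, T, U)` with the triple product property (tree definition
`Literature.Combinatorics.Additive.TripleProductProperty`, Cohn–Umans 2003 Def. 2.1) in a group `G`,
the two **shadows**
`P = S S⁻¹ U = {s s′⁻¹ u}` and `R = (T T⁻¹ ∖ {1}) U = {t t′⁻¹ u : t ≠ t′}`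
are DISJOINT (`shadow_disjoint`): `s s′⁻¹ u = t t′⁻¹ u′` rearranges to the TPP word
`s′s⁻¹ · t t′⁻¹ · u′u⁻¹ = 1`, forcing `t = t′`.  Since `P ⊇ s₀ · S⁻¹U` and `R ⊇ t₀ · (T∖{t₀})⁻¹U`
with the quotient maps injective (pairwise part of the TPP, tree lemmas `injOn_quot_outer`,
`injOn_quot_second`), in a finite group
`|U| · (|S| + |T| − 1) ≤ |G|` (`card_mul_le_of_tpp`), and by rotating the triple also
`|S| · (|T| + |U| − 1) ≤ |G|`, `|T| · (|U| + |S| − 1) ≤ |G|`.  In particular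
(`min_card_bound_of_tpp`) if all three sets have at least `k ≥ 1` elements then `k(2k − 1) ≤ |G|`,
i.e. `k ≤ (1 + √(1 + 8|G|))/4 ∼ √(|G|/2)`.

Context.  The packing bound (`|S||T| ≤ |G|`, Cohn–Umans 2003) allows balanced TPP triples of size
`≈ √|G|`; Blasiak–Cohn–Grochow–Pratt–Umans (arXiv:2204.03826, before Cor. 3.5) note that
`|S||T||U| < |G|^{3/2}` "does not rule out the possibility that `|S|, |T|, |U|` might be as large
as `⌊|G|^{1/2} − 1⌋`" and prove `|S||T||U| ≤ |G|^{3/2}/√2 + |G|` (Cor. 3.5) by Fourier analysis.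
The shadow inequality is elementary (double counting only), holds in every finite group, and
gives `min(|S|,|T|,|U|) ≤ √(|G|/2)·(1 + o(1))`, hence `|S||T||U| ≤ (|G|/2)^{3/2}(1 + o(1))` for
balanced triples — a factor `2` below Cor. 3.5 in that regime.  It is the `C = 0` end of the crux
`PolynomialSlack` (the reformulation `TPP ⟺ pairwise ∧ P ∩ R = ∅` is what the crux's lines prune);
it does not touch the polynomial factor `n^C`.  Observation of the lead prover of crux
stmt-MatrixMultiplication-8306 (2026-08-16); no source is claimed.
-/

open scoped BigOperators
open Finset
open Literature.Combinatorics.Additive (TripleProductProperty)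

-- `Summit.<Summit>.<Problem>`: single-problem summit, duplicate component by convention.
set_option linter.dupNamespace false

namespace Summit.MatrixMultiplication.MatrixMultiplication.Theorems.PolynomialSlack

section Group

variable {G : Type*} [Group G] [DecidableEq G] {S T U : Finset G}

omit [DecidableEq G] in
/-- The TPP is invariant under cyclic rotation of the triple `(S,T,U) ↦ (T,U,S)`
(conjugate the word `s s′⁻¹ · t t′⁻¹ · u u′⁻¹` by `s s′⁻¹`). -/
theorem tripleProductProperty_rotate (h : TripleProductProperty S T U) :
    TripleProductProperty T U S := by
  intro t ht t' ht' u hu u' hu' s hs s' hs' he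
  have key : s * s'⁻¹ * (t * t'⁻¹) * (u * u'⁻¹) = 1 := by
    have h2 : s * s'⁻¹ * (t * t'⁻¹ * (u * u'⁻¹) * (s * s'⁻¹)) * (s * s'⁻¹)⁻¹ = 1 := by
      rw [he]; group
    calc s * s'⁻¹ * (t * t'⁻¹) * (u * u'⁻¹)
        = s * s'⁻¹ * (t * t'⁻¹ * (u * u'⁻¹) * (s * s'⁻¹)) * (s * s'⁻¹)⁻¹ := by group
      _ = 1 := h2
  obtain ⟨h1, h2, h3⟩ := h s hs s' hs' t ht t' ht' u hu u' hu' key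
  exact ⟨h2, h3, h1⟩

/-- **Disjoint shadows.** For a TPP triple, the `S`-shadow `S S⁻¹ U = {s s′⁻¹ u}` and the
punctured `T`-shadow `(T T⁻¹ ∖ {1}) U = {t t′⁻¹ u : t ≠ t′}` of `U` are disjoint:
`s s′⁻¹ u = t t′⁻¹ u′` gives the TPP word `s′s⁻¹ · t t′⁻¹ · u′u⁻¹ = 1`, whence `t = t′`. -/
theorem shadow_disjoint (h : TripleProductProperty S T U) :
    Disjoint ((S ×ˢ S ×ˢ U).image (fun x : G × G × G => x.1 * x.2.1⁻¹ * x.2.2))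
      ((((T ×ˢ T).filter (fun tt : G × G => tt.1 ≠ tt.2)) ×ˢ U).image
        (fun x : (G × G) × G => x.1.1 * x.1.2⁻¹ * x.2)) := by
  rw [Finset.disjoint_left]
  intro g hP hR
  simp only [mem_image, mem_product, mem_filter] at hP hR
  obtain ⟨⟨s, s', u⟩, ⟨hs, hs', hu⟩, rfl⟩ := hP
  obtain ⟨⟨⟨t, t'⟩, u'⟩, ⟨⟨⟨ht, ht'⟩, hne⟩, hu'⟩, he⟩ := hR
  -- `t t'⁻¹ u' = s s'⁻¹ u`
  have key : s' * s⁻¹ * (t * t'⁻¹) * (u' * u⁻¹) = 1 := by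
    calc s' * s⁻¹ * (t * t'⁻¹) * (u' * u⁻¹)
        = s' * s⁻¹ * (t * t'⁻¹ * u') * u⁻¹ := by group
      _ = s' * s⁻¹ * (s * s'⁻¹ * u) * u⁻¹ := by rw [he]
      _ = 1 := by group
  obtain ⟨-, htt, -⟩ := h s' hs' s hs t ht t' ht' u' hu' u hu key
  exact hne htt

/-- The `S`-shadow contains the translate `s₀ · S⁻¹U`, which has `|S| · |U|` elements when `T`
is non-empty (the quotient map `(s,u) ↦ s⁻¹u` is injective on `S × U`, tree lemma
`injOn_quot_outer`). -/
theorem card_mul_card_le_card_shadow (h : TripleProductProperty S T U) (hS : S.Nonempty)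
    (hT : T.Nonempty) :
    S.card * U.card ≤ ((S ×ˢ S ×ˢ U).image (fun x : G × G × G => x.1 * x.2.1⁻¹ * x.2.2)).card := by
  obtain ⟨s₀, hs₀⟩ := hS
  have hsub : (S ×ˢ U).image (fun su : G × G => s₀ * su.1⁻¹ * su.2) ⊆
      (S ×ˢ S ×ˢ U).image (fun x : G × G × G => x.1 * x.2.1⁻¹ * x.2.2) := by
    intro g hg
    simp only [mem_image, mem_product] at hg ⊢
    obtain ⟨⟨s, u⟩, ⟨hs, hu⟩, rfl⟩ := hg
    exact ⟨(s₀, s, u), ⟨hs₀, hs, hu⟩, rfl⟩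
  have hinj : Set.InjOn (fun su : G × G => s₀ * su.1⁻¹ * su.2) ((S ×ˢ U : Finset (G × G)) : Set _) := by
    intro x hx y hy hxy
    have hx' : x ∈ (↑S ×ˢ ↑U : Set (G × G)) := by simpa only [coe_product] using hx
    have hy' : y ∈ (↑S ×ˢ ↑U : Set (G × G)) := by simpa only [coe_product] using hy
    refine injOn_quot_outer h hT hx' hy' ?_
    have hxy' : s₀ * x.1⁻¹ * x.2 = s₀ * y.1⁻¹ * y.2 := hxy
    exact mul_left_cancel (by simpa only [mul_assoc] using hxy')
  calc S.card * U.card = (S ×ˢ U).card := (card_product _ _).symm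
    _ = ((S ×ˢ U).image (fun su : G × G => s₀ * su.1⁻¹ * su.2)).card :=
        (card_image_of_injOn hinj).symm
    _ ≤ _ := card_le_card hsub

/-- The punctured `T`-shadow contains the translate `t₀ · (T ∖ {t₀})⁻¹U`, which has
`(|T| − 1) · |U|` elements when `S` is non-empty (the quotient map `(t,u) ↦ t⁻¹u` is injective on
`T × U`, tree lemma `injOn_quot_second`). -/
theorem card_mul_card_le_card_puncturedShadow (h : TripleProductProperty S T U) (hS : S.Nonempty)
    (hT : T.Nonempty) :
    (T.card - 1) * U.card ≤ ((((T ×ˢ T).filter (fun tt : G × G => tt.1 ≠ tt.2)) ×ˢ U).image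
        (fun x : (G × G) × G => x.1.1 * x.1.2⁻¹ * x.2)).card := by
  obtain ⟨t₀, ht₀⟩ := hT
  have hsub : ((T.erase t₀) ×ˢ U).image (fun tu : G × G => t₀ * tu.1⁻¹ * tu.2) ⊆
      (((T ×ˢ T).filter (fun tt : G × G => tt.1 ≠ tt.2)) ×ˢ U).image
        (fun x : (G × G) × G => x.1.1 * x.1.2⁻¹ * x.2) := by
    intro g hg
    simp only [mem_image, mem_product, mem_filter, mem_erase] at hg ⊢
    obtain ⟨⟨t, u⟩, ⟨⟨htne, ht⟩, hu⟩, rfl⟩ := hg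
    exact ⟨((t₀, t), u), ⟨⟨⟨ht₀, ht⟩, fun heq => htne heq.symm⟩, hu⟩, rfl⟩
  have hinj : Set.InjOn (fun tu : G × G => t₀ * tu.1⁻¹ * tu.2)
      (((T.erase t₀) ×ˢ U : Finset (G × G)) : Set _) := by
    intro x hx y hy hxy
    have hx' : x ∈ (↑T ×ˢ ↑U : Set (G × G)) := by
      have := mem_coe.1 hx
      simp only [mem_product, mem_erase] at this
      exact ⟨mem_coe.2 this.1.2, mem_coe.2 this.2⟩
    have hy' : y ∈ (↑T ×ˢ ↑U : Set (G × G)) := by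
      have := mem_coe.1 hy
      simp only [mem_product, mem_erase] at this
      exact ⟨mem_coe.2 this.1.2, mem_coe.2 this.2⟩
    refine injOn_quot_second h hS hx' hy' ?_
    have hxy' : t₀ * x.1⁻¹ * x.2 = t₀ * y.1⁻¹ * y.2 := hxy
    exact mul_left_cancel (by simpa only [mul_assoc] using hxy')
  calc (T.card - 1) * U.card = ((T.erase t₀) ×ˢ U).card := by
        rw [card_product, card_erase_of_mem ht₀]
    _ = (((T.erase t₀) ×ˢ U).image (fun tu : G × G => t₀ * tu.1⁻¹ * tu.2)).card :=
        (card_image_of_injOn hinj).symm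
    _ ≤ _ := card_le_card hsub

/-- **The shadow inequality.** For a TPP triple with `S, T` non-empty in a finite group,
`|U| · (|S| + |T| − 1) ≤ |G|`: the two disjoint shadows have at least `|S||U|` and `(|T|−1)|U|`
elements. -/
theorem card_mul_le_of_tpp [Fintype G] (h : TripleProductProperty S T U) (hS : S.Nonempty)
    (hT : T.Nonempty) : U.card * (S.card + T.card - 1) ≤ Fintype.card G := by
  have hdisj := shadow_disjoint h
  have h1 := card_mul_card_le_card_shadow h hS hT
  have h2 := card_mul_card_le_card_puncturedShadow h hS hT
  have hunion := card_union_of_disjoint hdisj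
  have hle := card_le_univ (((S ×ˢ S ×ˢ U).image (fun x : G × G × G => x.1 * x.2.1⁻¹ * x.2.2)) ∪
      ((((T ×ˢ T).filter (fun tt : G × G => tt.1 ≠ tt.2)) ×ˢ U).image
        (fun x : (G × G) × G => x.1.1 * x.1.2⁻¹ * x.2)))
  have hT1 : 1 ≤ T.card := hT.card_pos
  calc U.card * (S.card + T.card - 1) = S.card * U.card + (T.card - 1) * U.card := by
        rw [show S.card + T.card - 1 = S.card + (T.card - 1) by omega, mul_add, mul_comm,
          mul_comm U.card]
    _ ≤ _ := by omega

/-- Rotated shadow inequality: `|S| · (|T| + |U| − 1) ≤ |G|` (for `T, U` non-empty). -/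
theorem card_mul_le_of_tpp' [Fintype G] (h : TripleProductProperty S T U) (hT : T.Nonempty)
    (hU : U.Nonempty) : S.card * (T.card + U.card - 1) ≤ Fintype.card G :=
  card_mul_le_of_tpp (tripleProductProperty_rotate h) hT hU

/-- Rotated shadow inequality: `|T| · (|U| + |S| − 1) ≤ |G|` (for `U, S` non-empty). -/
theorem card_mul_le_of_tpp'' [Fintype G] (h : TripleProductProperty S T U) (hU : U.Nonempty)
    (hS : S.Nonempty) : T.card * (U.card + S.card - 1) ≤ Fintype.card G :=
  card_mul_le_of_tpp (tripleProductProperty_rotate (tripleProductProperty_rotate h)) hU hS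

/-- **Balanced TPP triples are at most `√(|G|/2)·(1+o(1))`.** If `(S,T,U)` has the TPP in a
finite group and all three sets have at least `k ≥ 1` elements, then `k · (2k − 1) ≤ |G|`, i.e.
`k ≤ (1 + √(1 + 8|G|))/4`.  (Blasiak–Cohn–Grochow–Pratt–Umans, arXiv:2204.03826, before Cor. 3.5,
record that the packing bound alone allows `k = ⌊√|G| − 1⌋`; their Cor. 3.5 gives
`k ≤ (|G|^{3/2}/√2 + |G|)^{1/3} ≈ 0.89 |G|^{1/2}`; this elementary bound gives `≈ 0.71 |G|^{1/2}`.) -/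
theorem min_card_bound_of_tpp [Fintype G] (h : TripleProductProperty S T U) {k : ℕ} (hk : 1 ≤ k)
    (hkS : k ≤ S.card) (hkT : k ≤ T.card) (hkU : k ≤ U.card) :
    k * (2 * k - 1) ≤ Fintype.card G := by
  have hS : S.Nonempty := card_pos.1 (by omega)
  have hT : T.Nonempty := card_pos.1 (by omega)
  have h1 := card_mul_le_of_tpp h hS hT
  calc k * (2 * k - 1) ≤ U.card * (S.card + T.card - 1) :=
        Nat.mul_le_mul hkU (by omega)
    _ ≤ _ := h1

/-- Real arithmetic behind the cubic shadow bound: if `1 ≤ a, b ≤ c` and `c (a + b - 1) ≤ g`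
then `a b c ≤ ((1 + √(1 + 8g))/4)³` (optimise `ab ≤ σ²/4`, `c ≤ g/(σ-1)` over `σ = a + b ≤ σ*`,
`σ*(σ*-1) = 2g`). -/
theorem shadow_arith {a b c g : ℝ} (ha : 1 ≤ a) (hb : 1 ≤ b) (hac : a ≤ c) (hbc : b ≤ c)
    (h : c * (a + b - 1) ≤ g) : a * b * c ≤ ((1 + Real.sqrt (1 + 8 * g)) / 4) ^ 3 := by
  set σ := a + b with hσ
  set r := Real.sqrt (1 + 8 * g) with hr
  have hσ2 : 2 ≤ σ := by rw [hσ]; linarith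
  have hc1 : 1 ≤ c := ha.trans hac
  have hg : c ≤ g := by nlinarith
  have hg1 : 1 ≤ g := hc1.trans hg
  have hr2 : r ^ 2 = 1 + 8 * g := by
    rw [hr, Real.sq_sqrt]; linarith
  have hr3 : 3 ≤ r := by
    rw [hr, Real.le_sqrt (by norm_num) (by linarith)]
    linarith
  -- σ* := (1 + r)/2 ≥ 2, the positive root of x² - x = 2g
  set τ := (1 + r) / 2 with hτ
  have hτ2 : 2 ≤ τ := by rw [hτ]; linarith
  have hτg : τ * (τ - 1) = 2 * g := by
    rw [hτ]; nlinarith [hr2]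
  -- (iii) σ(σ-1) ≤ 2g, since c ≥ σ/2
  have hcσ : σ / 2 ≤ c := by rw [hσ]; linarith
  have hσg : σ * (σ - 1) ≤ 2 * g := by nlinarith
  -- (iv) σ ≤ τ
  have hστ : σ ≤ τ := by
    by_contra hlt
    rw [not_le] at hlt
    -- x ↦ x(x-1) is increasing on [1/2, ∞): σ > τ ≥ 2 gives σ(σ-1) > τ(τ-1) = 2g
    have : τ * (τ - 1) < σ * (σ - 1) := by nlinarith
    linarith
  -- (i) ab ≤ σ²/4
  have hab : a * b ≤ σ ^ 2 / 4 := by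
    rw [hσ]; nlinarith [sq_nonneg (a - b)]
  -- (ii) c(σ-1) ≤ g with σ - 1 ≥ 1
  -- goal: a b c ≤ (τ/2)^3; we show σ² c ≤ τ³/2 … via σ²(τ-1) ≤ τ²(σ-1)
  have hmono : σ ^ 2 * (τ - 1) ≤ τ ^ 2 * (σ - 1) := by
    -- (τ - σ)(στ - σ - τ) ≥ 0
    have h1 : 0 ≤ τ - σ := by linarith
    have h2 : 0 ≤ σ * τ - σ - τ := by nlinarith
    nlinarith [mul_nonneg h1 h2]
  have hτ4 : ((1 + r) / 4) = τ / 2 := by rw [hτ]; ring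
  rw [hτ4]
  -- c ≤ g/(σ-1) = τ(τ-1)/(2(σ-1)); so 4abc ≤ σ² c ≤ σ² τ(τ-1)/(2(σ-1)) ≤ τ³/2
  have hσ1 : 0 < σ - 1 := by linarith
  have hcle : c * (σ - 1) ≤ τ * (τ - 1) / 2 := by
    have : c * (σ - 1) ≤ g := by
      have : c * (a + b - 1) = c * (σ - 1) := by rw [hσ]
      linarith
    linarith
  have habc : a * b * c ≤ σ ^ 2 / 4 * c := by
    have hc0 : 0 ≤ c := by linarith
    nlinarith
  -- σ²/4 · c · (σ-1) ≤ σ²/4 · τ(τ-1)/2 ≤ τ²(σ-1)/4 · τ/2 ... conclude by dividing by (σ-1) > 0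
  have key : (σ ^ 2 / 4 * c) * (σ - 1) ≤ (τ / 2) ^ 3 * (σ - 1) := by
    have hσ0 : 0 ≤ σ ^ 2 / 4 := by positivity
    calc (σ ^ 2 / 4 * c) * (σ - 1) = σ ^ 2 / 4 * (c * (σ - 1)) := by ring
      _ ≤ σ ^ 2 / 4 * (τ * (τ - 1) / 2) := by gcongr
      _ = (σ ^ 2 * (τ - 1)) * τ / 8 := by ring
      _ ≤ (τ ^ 2 * (σ - 1)) * τ / 8 := by gcongr
      _ = (τ / 2) ^ 3 * (σ - 1) := by ring
  have := le_of_mul_le_mul_right key hσ1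
  linarith

/-- **Cubic shadow bound.** For every TPP triple in a finite group,
`|S| · |T| · |U| ≤ ((1 + √(1 + 8|G|)) / 4)³ = (|G|/2)^{3/2} · (1 + O(|G|^{-1/2}))`
(apply the shadow inequality whose multiplier is the LARGEST of the three sets, then
`shadow_arith`).  Compare Blasiak–Cohn–Grochow–Pratt–Umans, arXiv:2204.03826, Cor. 3.5:
`|S||T||U| ≤ |G|^{3/2}/√2 + |G|`, i.e. `2·(|G|/2)^{3/2} + |G|`. -/
theorem card_mul_mul_le_of_tpp [Fintype G] (h : TripleProductProperty S T U) :
    ((S.card * T.card * U.card : ℕ) : ℝ) ≤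
      ((1 + Real.sqrt (1 + 8 * (Fintype.card G : ℝ))) / 4) ^ 3 := by
  rcases Nat.eq_zero_or_pos (S.card * T.card * U.card) with h0 | hpos
  · rw [h0]; push_cast; positivity
  have hS : S.Nonempty := card_pos.1 (Nat.pos_of_mul_pos_right (Nat.pos_of_mul_pos_right hpos))
  have hT : T.Nonempty := card_pos.1 (Nat.pos_of_mul_pos_left (Nat.pos_of_mul_pos_right hpos))
  have hU : U.Nonempty := card_pos.1 (Nat.pos_of_mul_pos_left hpos)
  have ha : (1 : ℝ) ≤ S.card := by exact_mod_cast hS.card_pos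
  have hb : (1 : ℝ) ≤ T.card := by exact_mod_cast hT.card_pos
  have hc : (1 : ℝ) ≤ U.card := by exact_mod_cast hU.card_pos
  -- the three shadow inequalities, cast to ℝ
  have e1 : (U.card : ℝ) * ((S.card : ℝ) + T.card - 1) ≤ Fintype.card G := by
    have := card_mul_le_of_tpp h hS hT
    have hc' : ((U.card * (S.card + T.card - 1) : ℕ) : ℝ) ≤ Fintype.card G := by exact_mod_cast this
    rw [Nat.cast_mul, Nat.cast_sub (by have := hS.card_pos; omega)] at hc'
    push_cast at hc'
    exact hc'
  have e2 : (S.card : ℝ) * ((T.card : ℝ) + U.card - 1) ≤ Fintype.card G := by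
    have := card_mul_le_of_tpp' h hT hU
    have hc' : ((S.card * (T.card + U.card - 1) : ℕ) : ℝ) ≤ Fintype.card G := by exact_mod_cast this
    rw [Nat.cast_mul, Nat.cast_sub (by have := hT.card_pos; omega)] at hc'
    push_cast at hc'
    exact hc'
  have e3 : (T.card : ℝ) * ((U.card : ℝ) + S.card - 1) ≤ Fintype.card G := by
    have := card_mul_le_of_tpp'' h hU hS
    have hc' : ((T.card * (U.card + S.card - 1) : ℕ) : ℝ) ≤ Fintype.card G := by exact_mod_cast this
    rw [Nat.cast_mul, Nat.cast_sub (by have := hU.card_pos; omega)] at hc'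
    push_cast at hc'
    exact hc'
  push_cast
  set a := (S.card : ℝ)
  set b := (T.card : ℝ)
  set c := (U.card : ℝ)
  rcases le_total a c with hac | hca
  · rcases le_total b c with hbc | hcb
    · exact shadow_arith ha hb hac hbc e1
    · -- b is the largest
      have := shadow_arith hc ha hcb (hac.trans hcb) e3
      linarith [show a * b * c = c * a * b by ring]
  · rcases le_total b a with hba | hab
    · -- a is the largest
      have := shadow_arith hb hc hba hca e2
      linarith [show a * b * c = b * c * a by ring]
    · -- b is the largest
      have := shadow_arith hc ha (hca.trans hab) hab e3
      linarith [show a * b * c = c * a * b by ring]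

end Group

/-- The shadow inequality in `S_n`, in the crux's currency: a TPP triple of subsets of `S_n` with
`|S|, |T|, |U| ≥ k ≥ 1` has `k(2k − 1) ≤ n!`. -/
theorem min_card_bound_perm {n k : ℕ} {S T U : Finset (Equiv.Perm (Fin n))}
    (h : TripleProductProperty S T U) (hk : 1 ≤ k) (hkS : k ≤ S.card) (hkT : k ≤ T.card)
    (hkU : k ≤ U.card) : k * (2 * k - 1) ≤ n.factorial := by
  have := min_card_bound_of_tpp h hk hkS hkT hkU
  rwa [Fintype.card_perm, Fintype.card_fin] at this

/-- **Realization form** (Cohn–Umans 2003, Defs. 2.1–2.2, tree `RealizesTPP`): if a finite group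
`G` realizes `⟨n, m, p⟩` then `n m p ≤ ((1 + √(1 + 8|G|))/4)³`.  Equality holds for
`S₃ = ⟨2,2,2⟩` (`|G| = 6 = 2·3`, `nmp = 8 = 2³`): this recovers that the pseudo-exponent of `S₃` is
exactly `log₂ 6` (Cohn–Umans 2003, after Lemma 3.1/Lemma 4: "one can check that it is exactly
`log₂ 6`") and gives the quantitative form `α(G) ≥ log |G| / log ((1 + √(1 + 8|G|))/4) > 2` of
their Lemma "the pseudo-exponent is always greater than `2`" for every finite group. -/
theorem realizesTPP_mul_mul_le {G : Type*} [Group G] [Fintype G] {n m p : ℕ}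
    (h : Literature.Computability.AlgebraicComplexity.RealizesTPP G n m p) :
    ((n * m * p : ℕ) : ℝ) ≤ ((1 + Real.sqrt (1 + 8 * (Fintype.card G : ℝ))) / 4) ^ 3 := by
  classical
  obtain ⟨S, T, U, rfl, rfl, rfl, hTPP⟩ := h
  exact card_mul_mul_le_of_tpp hTPP

/-- The cubic shadow bound in `S_n`: every TPP triple of subsets of `S_n` has
`|S||T||U| ≤ ((1 + √(1 + 8·n!))/4)³ ∼ (n!/2)^{3/2}` — the `C = 0` end of `PolynomialSlack` with the
constant `2^{-3/2}`. -/
theorem card_mul_mul_le_perm {n : ℕ} {S T U : Finset (Equiv.Perm (Fin n))}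
    (h : TripleProductProperty S T U) :
    ((S.card * T.card * U.card : ℕ) : ℝ) ≤
      ((1 + Real.sqrt (1 + 8 * (n.factorial : ℝ))) / 4) ^ 3 := by
  have := card_mul_mul_le_of_tpp h
  rwa [Fintype.card_perm, Fintype.card_fin] at this

end Summit.MatrixMultiplication.MatrixMultiplication.Theorems.PolynomialSlack
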